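import Summits.QuantumFields.YangMills.Theorems.PoincareLipschitzIteratedOfAvgStabilityModGauge
import Literature.MathematicalPhysics.QuantumFieldTheory.Balaban1983to89.B10Eq38TorusDomains
import Literature.MathematicalPhysics.QuantumFieldTheory.Balaban1983to89.T4WilsonLinkAffine
import HarnessLib

/-!
# Crux stmt-QuantumFields-19936 `HistoryTailL`, line `poincare_lipschitz`, route crux `BlockLipschitzL` (stmt-QuantumFields-23533):
# the GAUGE INFIMUM of the K2-TOP door's displayed row is LOAD-BEARING — the un-quotiented row is FALSE (kernel certificate)

The K2-TOP door ✓`PoincareLipschitzIteratedOfAvgStability.stub_iteratedLipschitz_of_avgStabilityModGauge` (p679967) reduces the `j ≥ 2` stub of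
`BlockLipschitzL` to the row «for hierarchically small pairs `U, U'` there is a level-`j` gauge transformation `h` with
`dist1(Ū^j(U)_b·((Ū^j U')^h_b)⁻¹) ≤ CS/√(L^{j+1})·‖U − U'‖_{ℓ²(box)}` on the footprint of `∂a`».  THIS FILE proves that the same row WITHOUT
the gauge transformation (`h := 1` forced) is FALSE (`not_avgStability_unquotiented`), so no supplier may drop the `∃ h` and no planner may
register the un-quotiented text as a stub.

WITNESS (one-site gauge move).  `L = 3`, thresholds `b₀ = 1, p₀ = 3`, the `γ₁` the row provides, `K = j + 3` with `j` so large that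
`6·CS² < 3^{j+1}`; `U := 1` and `U' := 1^g` with `g = −1` at the single finest site `x₀ = toFine j (emb c₋)` under the centre of the block `c₋ = a.src`
and `g = 1` elsewhere.  Both fields are hierarchically small at every height (all averaged plaquette variables equal `1`: `Ū^i(1) = 1` for the
(0.4) average of record, `Ū^i(1^g) = 1^{g∘toFine i}` by covariance ✓`T4Continuum.iter_gaugeAct`, and a pure gauge has trivial plaquettes).  On the
footprint bond `b = (emb c₋, dir c)` of level `j`: `Ū^j(U)_b = 1`, `Ū^j(U')_b = g(x₀)·g(toFine j b₊)⁻¹ = −1` (`toFine j` is injective), so the left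
side is `dist1(−1) > 0`; the box sum is at most the full sum `Σ_b dist1(U'_b)² = dist1(−1)²·#{b : x₀ ∈ b} = 6·dist1(−1)²`.  The row would give
`dist1(−1) ≤ CS·√6·dist1(−1)/√(3^{j+1}) < dist1(−1)`.  With `h := g∘toFine j` the door's row holds trivially for this pair (left side `0`), which is
why the door carries `∃ h`.

WHAT THIS IS NOT: nothing here bears on the truth of the door's row itself (Bałaban's averaging regularity modulo gauge), on `BlockLipschitzL`,
`HistoryTailL`, rung R3 (YM₃ on T³ — not d = 4, not infinite volume, not a mass gap, not the Clay problem) or a summit statement.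
LEAD seat ym-ust-19936-w1 g7 (cell ym3-torus), `--supports stmt-QuantumFields-23533`.
-/

noncomputable section

open scoped BigOperators Matrix.Norms.L2Operator

namespace Summit.QuantumFields.YangMills.Theorems.PoincareLipschitzAvgStabilityGaugeWitness

open Literature.MathematicalPhysics.QuantumFieldTheory.Balaban1983to89
open Literature.MathematicalPhysics.QuantumFieldTheory.Balaban1983to89.T3ContinuumYM3Torus
open Literature.MathematicalPhysics.QuantumFieldTheory.Balaban1983to89.T3UnitLawDensityEML
open Literature.MathematicalPhysics.QuantumFieldTheory.Balaban1983to89.B10Eq38TorusDomains (toFine toFine_zero toFine_succ)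
open T4Continuum BlockAveraging AveragingRT ExpMeanLog T3UnitScaleTilt

/-! ## §1 The identity field and pure gauges have trivial averaged plaquette variables -/

section Trivial

variable {P : Params} {j : ℕ}

/-- Transport of the identity field along any step list is `1`. [folklore] -/
private theorem holAt_one (γ : List (LStep P j)) :
    holAt (1 : GaugeField P j (Matrix.specialUnitaryGroup (Fin 2) ℂ)) γ = 1 := by
  induction γ with
  | nil => exact holAt_nil _
  | cons s γ ih =>
      rw [holAt_cons, ih]
      have : (1 : GaugeField P j (Matrix.specialUnitaryGroup (Fin 2) ℂ)) s.bond = 1 := rfl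
      rw [this]; simp

/-- The straight transporter of the identity field is `1`. [folklore] -/
private theorem pathProd_one (c : PBond P (j + 1)) (n : ℕ) :
    pathProd (1 : GaugeField P j (Matrix.specialUnitaryGroup (Fin 2) ℂ)) c n = 1 := by
  induction n with
  | zero => rfl
  | succ n ih =>
      show pathProd (1 : GaugeField P j (Matrix.specialUnitaryGroup (Fin 2) ℂ)) c n *
        (1 : GaugeField P j (Matrix.specialUnitaryGroup (Fin 2) ℂ)) (line c n) = 1
      rw [ih, show (1 : GaugeField P j (Matrix.specialUnitaryGroup (Fin 2) ℂ)) (line c n) = 1 from rfl, one_mul]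

/-- The printed small-loop average of the constant family `1` is `1` (`eml 1 = 1`, and the off-guard value is `1` too). [folklore] -/
private theorem ℰp_avg_const_one {ι : Type*} [Fintype ι] [Nonempty ι] :
    ℰp.avg (fun _ : ι => (1 : Matrix.specialUnitaryGroup (Fin 2) ℂ)) = 1 := by
  show ESU _ = 1
  apply Subtype.ext
  show ((ESU _ : Matrix.specialUnitaryGroup (Fin 2) ℂ) : Matrix (Fin 2) (Fin 2) ℂ) = 1
  by_cases h : ∀ i : Fin (Fintype.card ι - 1 + 1),
      ‖((((fun _ : ι => (1 : Matrix.specialUnitaryGroup (Fin 2) ℂ)) ∘ (LoopAverage.enum ι).symm) i :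
        Matrix.specialUnitaryGroup (Fin 2) ℂ) : Matrix (Fin 2) (Fin 2) ℂ) - 1‖ < deltaSU (Fin 2)
  · rw [coe_ESU_of_small h]
    have : (fun i : Fin (Fintype.card ι - 1 + 1) =>
        ((((fun _ : ι => (1 : Matrix.specialUnitaryGroup (Fin 2) ℂ)) ∘ (LoopAverage.enum ι).symm) i :
          Matrix.specialUnitaryGroup (Fin 2) ℂ) : Matrix (Fin 2) (Fin 2) ℂ)) = 1 := by
      funext i; rfl
    rw [this]
    exact BlockAveragingEMLAnalyticMean.eml_one
  · rw [ESU_of_not_small h]; rfl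

/-- **`Ū(1) = 1`** for the (0.4) averaging of record. [folklore] -/
theorem avgFun_ℰp_one : avgFun ℰp (1 : GaugeField P j (Matrix.specialUnitaryGroup (Fin 2) ℂ)) = 1 := by
  funext c
  show corr ℰp (1 : GaugeField P j (Matrix.specialUnitaryGroup (Fin 2) ℂ)) c * axialAvg 1 c = 1
  have hax : axialAvg (1 : GaugeField P j (Matrix.specialUnitaryGroup (Fin 2) ℂ)) c = 1 := pathProd_one c P.L
  have hloop : loopHol (1 : GaugeField P j (Matrix.specialUnitaryGroup (Fin 2) ℂ)) c =
      fun _ => (1 : Matrix.specialUnitaryGroup (Fin 2) ℂ) := by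
    funext i; exact holAt_one _
  have hcorr : corr ℰp (1 : GaugeField P j (Matrix.specialUnitaryGroup (Fin 2) ℂ)) c = 1 := by
    unfold corr
    split_ifs with h
    · rw [hloop]; exact ℰp_avg_const_one
    · rfl
  rw [hcorr, hax, one_mul]

/-- **`Ū^k(1) = 1`**. [folklore] -/
theorem iter_ℰp_one (k : ℕ) :
    Averaging.iter (fun i' => BlockAveraging.blockAvg (P := P) (j := i') ℰp) k
      (1 : GaugeField P 0 (Matrix.specialUnitaryGroup (Fin 2) ℂ)) = 1 := by
  induction k with
  | zero => rfl
  | succ k ih =>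
      show avgFun ℰp (Averaging.iter (fun i' => BlockAveraging.blockAvg (P := P) (j := i') ℰp) k
        (1 : GaugeField P 0 (Matrix.specialUnitaryGroup (Fin 2) ℂ))) = 1
      rw [ih]; exact avgFun_ℰp_one

/-- Plaquette variables of the identity field are `1`. [folklore] -/
private theorem plaqHol_one {G : Type*} [GaugeGroup G] (q : Plaq P j) : GaugeField.plaqHol (1 : GaugeField P j G) q = 1 := by
  show (1 : G) * 1 * (1 : G)⁻¹ * (1 : G)⁻¹ = 1
  simp

/-- Plaquette variables of a pure gauge are `1`. [folklore] -/
theorem plaqHol_gaugeAct_one {G : Type*} [GaugeGroup G] (u : GaugeTransf P j G) (q : Plaq P j) :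
    GaugeField.plaqHol (GaugeField.gaugeAct u (1 : GaugeField P j G)) q = 1 := by
  rw [T4WilsonGaugeFlatDirection.plaqHol_gaugeAct, plaqHol_one]; simp

/-- The restriction up the levels reads the finest transformation at the iterated centre: `u^{(k)}(y) = u(toFine k y)`. [folklore] -/
theorem transfUp_eq_toFine {G : Type*} [GaugeGroup G] (u : GaugeTransf P 0 G) : ∀ (k : ℕ) (y : Site P k), transfUp u k y = u (toFine k y)
  | 0, _ => rfl
  | k + 1, y => transfUp_eq_toFine u k (emb y)

/-- `emb` is injective in the standing range (`blockOf ∘ emb = id`). [folklore] -/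
private theorem emb_injective (hj : j + 1 ≤ P.m + P.K) : Function.Injective (emb : Site P (j + 1) → Site P j) :=
  Function.LeftInverse.injective (g := blockOf) fun y => Site.blockOf_emb hj y

/-- `toFine k` is injective in the standing range. [folklore] -/
theorem toFine_injective {k : ℕ} (hk : k ≤ P.m + P.K) : Function.Injective (toFine k : Site P k → Site P 0) := by
  induction k with
  | zero => intro x y h; exact h
  | succ k ih => intro x y h; exact emb_injective hk (ih (Nat.le_of_succ_le hk) h)

/-- `(x − e_μ) + e_μ = x`. [folklore] -/
private theorem shift_unshift (x : Site P j) (μ : Fin P.d) : (x.unshift μ).shift μ = x := by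
  funext κ
  simp only [Site.shift, Site.unshift]
  by_cases hκ : κ = μ
  · subst hκ; simp
  · rw [Function.update_of_ne hκ, Function.update_of_ne hκ]

/-- `(x + e_μ) − e_μ = x`. [folklore] -/
private theorem unshift_shift (x : Site P j) (μ : Fin P.d) : (x.shift μ).unshift μ = x := by
  funext κ
  simp only [Site.shift, Site.unshift]
  by_cases hκ : κ = μ
  · subst hκ; simp
  · rw [Function.update_of_ne hκ, Function.update_of_ne hκ]

/-- The centre of a block shifted by one step stays in the block (`L ≥ 3`). [folklore] -/
theorem blockOf_shift_emb (hj : j + 1 ≤ P.m + P.K) (hL : 3 ≤ P.L) (y : Site P (j + 1)) (μ : Fin P.d) :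
    blockOf ((emb y).shift μ) = y := by
  funext κ
  apply ZMod.val_injective
  rw [Site.val_blockOf hj]
  by_cases hκ : κ = μ
  · subst hκ
    have hval : (((emb y).shift κ) κ).val = (y κ).val * P.L + (P.L - 1) / 2 + 1 := by
      simp only [Site.shift, Function.update_self]
      rw [ZMod.val_add, Site.val_emb hj, ZMod.val_one, Nat.mod_eq_of_lt]
      have hy : (y κ).val + 1 ≤ P.sitesPerDir (j + 1) := ZMod.val_lt (y κ)
      have hN : P.sitesPerDir j = P.sitesPerDir (j + 1) * P.L := P.sitesPerDir_eq_mul_succ hj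
      have h1 : ((y κ).val + 1) * P.L ≤ P.sitesPerDir (j + 1) * P.L := Nat.mul_le_mul_right _ hy
      have h2 : (P.L - 1) / 2 + 2 ≤ P.L := by omega
      rw [hN]; rw [Nat.add_mul, one_mul] at h1; omega
    rw [hval]
    have h2 : (P.L - 1) / 2 + 1 < P.L := by omega
    rw [Nat.add_assoc, Nat.add_comm, Nat.add_mul_div_right _ _ (by omega), Nat.div_eq_of_lt h2, zero_add]
  · have : ((emb y).shift μ) κ = (emb y) κ := by simp only [Site.shift, Function.update_of_ne hκ]
    rw [this, ← Site.val_blockOf hj, Site.blockOf_emb hj]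

end Trivial

/-! ## §2 A non-trivial element of `SU(2)` -/

section SU2

/-- `−1 ∈ SU(2)`. [folklore] -/
private theorem negOne_mem : (-1 : Matrix (Fin 2) (Fin 2) ℂ) ∈ Matrix.specialUnitaryGroup (Fin 2) ℂ := by
  rw [Matrix.mem_specialUnitaryGroup_iff]
  refine ⟨?_, ?_⟩
  · rw [Matrix.mem_unitaryGroup_iff]; simp
  · simp [Matrix.det_neg]

/-- `dist1(−1) > 0` in `SU(2)`. [folklore] -/
private theorem dist1_negOne_pos : 0 < dist1 (⟨-1, negOne_mem⟩ : Matrix.specialUnitaryGroup (Fin 2) ℂ) := by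
  rw [FederbushMean.dist1_SU_eq]
  apply norm_pos_iff.mpr
  intro h
  have h1 := congrFun (congrFun (sub_eq_zero.mp h) 0) 0
  norm_num at h1

end SU2

/-! ## §3 The un-quotiented row is false -/

section Witness

/-- The `L = 3`, `m = 1` family. [folklore] -/
private theorem odd_three : Odd 3 ∧ 1 < 3 := ⟨⟨1, rfl⟩, by norm_num⟩

/-- ★ **THE GAUGE INFIMUM IS LOAD-BEARING**: the K2-TOP door's displayed row WITH `h := 1` FORCED (no gauge transformation on `Ū^j(U')`) is
FALSE — one-site gauge witness `U := 1`, `U' := 1^g`, `g = −1` at `toFine j (emb a.src)`, `L = 3`, `K = j + 3`, `3^{j+1} > 6·CS²`. [folklore] -/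
theorem not_avgStability_unquotiented :
    ¬ (open Literature.MathematicalPhysics.QuantumFieldTheory.Balaban1983to89 Literature.MathematicalPhysics.QuantumFieldTheory.Balaban1983to89.T3ContinuumYM3Torus in ∀ (L : ℕ), ∃ CS : ℝ, 0 ≤ CS ∧ ∀ (b₀ p₀ : ℝ), 0 < b₀ → 2 < p₀ → ∃ γ₁ : ℝ, 0 < γ₁ ∧ γ₁ ≤ 1 ∧ ∀ (F : T3Family) (γ : ℝ), F.L = L → 0 < γ → γ ≤ γ₁ → ∀ (K j : ℕ), 1 ≤ j → j + 3 ≤ K → ∀ (a : Plaq (F.P K) (j + 1)) (U U' : GaugeField (F.P K) 0 (Matrix.specialUnitaryGroup (Fin 2) ℂ)), (∀ (i : ℕ) (q : Plaq (F.P K) i), i < j + 1 → Site.tdist (fun k => ((((q.src k).val * F.L ^ i : ℕ)) : ZMod ((F.P K).sitesPerDir 0))) (fun k => ((((a.src k).val * F.L ^ (j + 1) : ℕ)) : ZMod ((F.P K).sitesPerDir 0))) + 64 * F.L ^ i ≤ 64 * F.L ^ (j + 1) → GaugeGroup.dist1 (GaugeField.plaqHol (Averaging.iter (fun i' => BlockAveraging.blockAvg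 (P := F.P K) (j := i') T3UnitLawDensityEML.ℰp) i U) q) < T3UnitScaleTilt.θBal F.L γ b₀ p₀ (K - i)) → (∀ (i : ℕ) (q : Plaq (F.P K) i), i < j + 1 → Site.tdist (fun k => ((((q.src k).val * F.L ^ i : ℕ)) : ZMod ((F.P K).sitesPerDir 0))) (fun k => ((((a.src k).val * F.L ^ (j + 1) : ℕ)) : ZMod ((F.P K).sitesPerDir 0))) + 64 * F.L ^ i ≤ 64 * F.L ^ (j + 1) → GaugeGroup.dist1 (GaugeField.plaqHol (Averaging.iter (fun i' => BlockAveraging.blockAvg (P := F.P K) (j := i') T3UnitLawDensityEML.ℰp) i U') q) < T3UnitScaleTilt.θBal F.L γ b₀ p₀ (K - i)) → ∀ c : PBond (F.P K) (j + 1), (c = ⟨a.src, a.μ⟩ ∨ c = ⟨a.src.shift a.μ, a.ν⟩ ∨ c = ⟨a.src.shift a.ν, a.μ⟩ ∨ c = ⟨a.src, a.ν⟩) → ∀ b : PBond (F.P K) j, (blockOf b.src = c.src ∨ blockOf b.src = c.tgt) → (blockOf b.tgt = c.src ∨ blockOf b.tgt = c.tgt) → GaugeGroup.dist1 (Averaging.iter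 (fun i' => BlockAveraging.blockAvg (P := F.P K) (j := i') T3UnitLawDensityEML.ℰp) j U b * (Averaging.iter (fun i' => BlockAveraging.blockAvg (P := F.P K) (j := i') T3UnitLawDensityEML.ℰp) j U' b)⁻¹) ≤ CS / Real.sqrt ((F.L : ℝ) ^ (j + 1)) * Real.sqrt (∑ b : PBond (F.P K) 0, if (∀ k, (b.src k - ((((a.src k).val * F.L ^ (j + 1) : ℕ)) : ZMod ((F.P K).sitesPerDir 0)) + ((8 * F.L ^ (j + 1) : ℕ) : ZMod ((F.P K).sitesPerDir 0))).val < 17 * F.L ^ (j + 1)) ∧ (∀ k, (b.tgt k - ((((a.src k).val * F.L ^ (j + 1) : ℕ)) : ZMod ((F.P K).sitesPerDir 0)) + ((8 * F.L ^ (j + 1) : ℕ) : ZMod ((F.P K).sitesPerDir 0))).val < 17 * F.L ^ (j + 1)) then GaugeGroup.dist1 (U b * (U' b)⁻¹) ^ 2 else 0)) := by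
  intro H
  obtain ⟨CS, hCS, H1⟩ := H 3
  obtain ⟨γ₁, hγ₁, hγ₁1, H2⟩ := H1 1 3 one_pos (by norm_num)
  -- a depth `j ≥ 1` with `6·CS² < 3^{j+1}`
  obtain ⟨j, hj1, hj⟩ : ∃ j : ℕ, 1 ≤ j ∧ 6 * CS ^ 2 < (3 : ℝ) ^ (j + 1) := by
    obtain ⟨n, hn⟩ := pow_unbounded_of_one_lt (6 * CS ^ 2) (by norm_num : (1 : ℝ) < 3)
    refine ⟨n + 1, by omega, hn.trans ?_⟩
    exact pow_lt_pow_right₀ (by norm_num) (by omega)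
  -- the family, the plaquette, the bond, the site, the fields
  let F : T3Family := ⟨3, odd_three, 1, le_rfl⟩
  set K : ℕ := j + 3 with hK
  have hjr : j + 1 ≤ (F.P K).m + (F.P K).K := by show j + 1 ≤ 1 + (j + 3); omega
  have hjK : j ≤ (F.P K).m + (F.P K).K := by show j ≤ 1 + (j + 3); omega
  have hd : (F.P K).d = 3 := rfl
  have hPL : (F.P K).L = 3 := rfl
  let a : Plaq (F.P K) (j + 1) := ⟨fun _ => 0, ⟨0, by rw [hd]; norm_num⟩, ⟨1, by rw [hd]; norm_num⟩, by
    show (⟨0, _⟩ : Fin (F.P K).d) < ⟨1, _⟩; exact Fin.mk_lt_mk.mpr zero_lt_one⟩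
  let c : PBond (F.P K) (j + 1) := ⟨a.src, a.μ⟩
  let bj : PBond (F.P K) j := ⟨emb c.src, c.dir⟩
  let x₀ : Site (F.P K) 0 := toFine j (emb c.src)
  let g₀ : Matrix.specialUnitaryGroup (Fin 2) ℂ := ⟨-1, negOne_mem⟩
  let g : GaugeTransf (F.P K) 0 (Matrix.specialUnitaryGroup (Fin 2) ℂ) := fun x => if x = x₀ then g₀ else 1
  let U : GaugeField (F.P K) 0 (Matrix.specialUnitaryGroup (Fin 2) ℂ) := 1
  let U' : GaugeField (F.P K) 0 (Matrix.specialUnitaryGroup (Fin 2) ℂ) := GaugeField.gaugeAct g 1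
  -- both fields are hierarchically small: every averaged plaquette variable is `1`
  have hθpos : ∀ i, 0 < θBal F.L γ₁ 1 3 (K - i) := fun i =>
    T3MinimiserStabilityReduction.θBal_pos (by show 1 ≤ 3; norm_num) hγ₁ hγ₁1 one_pos 3 (K - i)
  have hW : (∀ (i : ℕ) (q : Plaq (F.P K) i), i < j + 1 → Site.tdist (fun k => ((((q.src k).val * F.L ^ i : ℕ)) : ZMod ((F.P K).sitesPerDir 0))) (fun k => ((((a.src k).val * F.L ^ (j + 1) : ℕ)) : ZMod ((F.P K).sitesPerDir 0))) + 64 * F.L ^ i ≤ 64 * F.L ^ (j + 1) → GaugeGroup.dist1 (GaugeField.plaqHol (Averaging.iter (fun i' => BlockAveraging.blockAvg (P := F.P K) (j := i') T3UnitLawDensityEML.ℰp) i U) q) < T3UnitScaleTilt.θBal F.L γ₁ 1 3 (K - i)) := by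
    intro i q _ _
    have h1 : Averaging.iter (fun i' => BlockAveraging.blockAvg (P := F.P K) (j := i') ℰp) i U = 1 := iter_ℰp_one i
    rw [h1, plaqHol_one, GaugeGroup.dist1_one]
    exact hθpos i
  have hiter' : ∀ i, i ≤ (F.P K).m + (F.P K).K →
      Averaging.iter (fun i' => BlockAveraging.blockAvg (P := F.P K) (j := i') ℰp) i U' =
        GaugeField.gaugeAct (transfUp g i) 1 := by
    intro i hi
    show Averaging.iter (fun i' => BlockAveraging.blockAvg (P := F.P K) (j := i') ℰp) i (GaugeField.gaugeAct g 1) = _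
    rw [T4Continuum.iter_gaugeAct _ g i hi, iter_ℰp_one]
  have hW' : (∀ (i : ℕ) (q : Plaq (F.P K) i), i < j + 1 → Site.tdist (fun k => ((((q.src k).val * F.L ^ i : ℕ)) : ZMod ((F.P K).sitesPerDir 0))) (fun k => ((((a.src k).val * F.L ^ (j + 1) : ℕ)) : ZMod ((F.P K).sitesPerDir 0))) + 64 * F.L ^ i ≤ 64 * F.L ^ (j + 1) → GaugeGroup.dist1 (GaugeField.plaqHol (Averaging.iter (fun i' => BlockAveraging.blockAvg (P := F.P K) (j := i') T3UnitLawDensityEML.ℰp) i U') q) < T3UnitScaleTilt.θBal F.L γ₁ 1 3 (K - i)) := by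
    intro i q hi _
    rw [hiter' i (by show i ≤ 1 + (j + 3); omega), plaqHol_gaugeAct_one, GaugeGroup.dist1_one]
    exact hθpos i
  -- the footprint bond `bj = (emb c₋, dir c)`
  have hsrc : blockOf bj.src = c.src ∨ blockOf bj.src = c.tgt := Or.inl (Site.blockOf_emb hjr c.src)
  have htgt : blockOf bj.tgt = c.src ∨ blockOf bj.tgt = c.tgt :=
    Or.inl (blockOf_shift_emb hjr (by rw [hPL]) c.src c.dir)
  have key := H2 F γ₁ rfl hγ₁ le_rfl K j hj1 (by omega) a U U' hW hW' c (Or.inl rfl) bj hsrc htgt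
  -- LEFT side: `dist1 (1 · (g(x₀) · 1 · g(toFine j bj₊)⁻¹)⁻¹) = dist1 g₀`
  have hx₀ : transfUp g j bj.src = g₀ := by
    rw [transfUp_eq_toFine]
    show (if toFine j (emb c.src) = x₀ then g₀ else 1) = g₀
    rw [if_pos rfl]
  have hx₁ : transfUp g j bj.tgt = 1 := by
    rw [transfUp_eq_toFine]
    show (if toFine j ((emb c.src).shift c.dir) = x₀ then g₀ else 1) = 1
    rw [if_neg]
    intro h
    exact T4WilsonLinkAffine.shift_ne_self (emb c.src) c.dir (toFine_injective hjK h)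
  have hLHS : GaugeGroup.dist1 (Averaging.iter (fun i' => BlockAveraging.blockAvg (P := F.P K) (j := i') ℰp) j U bj *
      (Averaging.iter (fun i' => BlockAveraging.blockAvg (P := F.P K) (j := i') ℰp) j U' bj)⁻¹) = dist1 g₀ := by
    rw [iter_ℰp_one, hiter' j hjK]
    show GaugeGroup.dist1 ((1 : Matrix.specialUnitaryGroup (Fin 2) ℂ) *
      (transfUp g j bj.src * 1 * (transfUp g j bj.tgt)⁻¹)⁻¹) = dist1 g₀
    rw [hx₀, hx₁, one_mul, mul_one, inv_one, mul_one, GaugeGroup.dist1_inv]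
  -- RIGHT side: the box sum is at most `6 · dist1(g₀)²`
  have hterm : ∀ b : PBond (F.P K) 0, GaugeGroup.dist1 (U b * (U' b)⁻¹) ^ 2 ≤
      dist1 g₀ ^ 2 * ((if b.src = x₀ then 1 else 0) + (if b.tgt = x₀ then 1 else 0)) := by
    intro b
    show GaugeGroup.dist1 ((1 : Matrix.specialUnitaryGroup (Fin 2) ℂ) * (g b.src * 1 * (g b.tgt)⁻¹)⁻¹) ^ 2 ≤ _
    rw [one_mul, GaugeGroup.dist1_inv, mul_one]
    have hne : ¬ (b.src = x₀ ∧ b.tgt = x₀) := fun h => T4WilsonLinkAffine.shift_ne_self b.src b.dir (h.2.trans h.1.symm)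
    by_cases hs : b.src = x₀
    · have ht : ¬ b.tgt = x₀ := fun ht => hne ⟨hs, ht⟩
      have e : g b.src * (g b.tgt)⁻¹ = g₀ := by
        show (if b.src = x₀ then g₀ else 1) * (if b.tgt = x₀ then g₀ else 1)⁻¹ = g₀
        rw [if_pos hs, if_neg ht, inv_one, mul_one]
      rw [e, if_pos hs, if_neg ht]; norm_num
    · by_cases ht : b.tgt = x₀
      · have e : g b.src * (g b.tgt)⁻¹ = g₀⁻¹ := by
          show (if b.src = x₀ then g₀ else 1) * (if b.tgt = x₀ then g₀ else 1)⁻¹ = g₀⁻¹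
          rw [if_neg hs, if_pos ht, one_mul]
        rw [e, GaugeGroup.dist1_inv, if_neg hs, if_pos ht]; norm_num
      · have e : g b.src * (g b.tgt)⁻¹ = 1 := by
          show (if b.src = x₀ then g₀ else 1) * (if b.tgt = x₀ then g₀ else 1)⁻¹ = 1
          rw [if_neg hs, if_neg ht, inv_one, mul_one]
        rw [e, GaugeGroup.dist1_one, if_neg hs, if_neg ht]; norm_num
  -- counting the bonds at `x₀`: sums over bonds are double sums over (site, direction)
  have hsum : ∀ f : PBond (F.P K) 0 → ℝ, ∑ b, f b = ∑ x : Site (F.P K) 0, ∑ μ : Fin (F.P K).d, f ⟨x, μ⟩ := by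
    intro f
    rw [← Fintype.sum_prod_type']
    exact (Fintype.sum_equiv (⟨fun p => ⟨p.1, p.2⟩, fun b => (b.src, b.dir), fun _ => rfl, fun _ => rfl⟩ :
      Site (F.P K) 0 × Fin (F.P K).d ≃ PBond (F.P K) 0) (fun p => f ⟨p.1, p.2⟩) f (fun _ => rfl)).symm
  have hcount_src : ∑ b : PBond (F.P K) 0, (if b.src = x₀ then (1 : ℝ) else 0) = 3 := by
    rw [hsum, Finset.sum_comm]
    simp only [Finset.sum_ite_eq', Finset.mem_univ, if_true, Finset.sum_const, Finset.card_univ,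
      Fintype.card_fin, hd]
    norm_num
  have hshift : ∀ (x : Site (F.P K) 0) (μ : Fin (F.P K).d), x.shift μ = x₀ ↔ x = x₀.unshift μ := by
    intro x μ
    constructor
    · intro h; rw [← h, unshift_shift]
    · intro h; rw [h, shift_unshift]
  have hcount_tgt : ∑ b : PBond (F.P K) 0, (if b.tgt = x₀ then (1 : ℝ) else 0) = 3 := by
    rw [hsum]
    have e : ∀ (x : Site (F.P K) 0) (μ : Fin (F.P K).d),
        (if (⟨x, μ⟩ : PBond (F.P K) 0).tgt = x₀ then (1 : ℝ) else 0) = if x = x₀.unshift μ then 1 else 0 := by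
      intro x μ
      have : (⟨x, μ⟩ : PBond (F.P K) 0).tgt = x.shift μ := rfl
      rw [this]
      by_cases h : x.shift μ = x₀
      · rw [if_pos h, if_pos ((hshift x μ).mp h)]
      · rw [if_neg h, if_neg (fun h' => h ((hshift x μ).mpr h'))]
    simp only [e]
    rw [Finset.sum_comm]
    simp only [Finset.sum_ite_eq', Finset.mem_univ, if_true, Finset.sum_const, Finset.card_univ,
      Fintype.card_fin, hd]
    norm_num
  have hS : (∑ b : PBond (F.P K) 0, if (∀ k, (b.src k - ((((a.src k).val * F.L ^ (j + 1) : ℕ)) : ZMod ((F.P K).sitesPerDir 0)) + ((8 * F.L ^ (j + 1) : ℕ) : ZMod ((F.P K).sitesPerDir 0))).val < 17 * F.L ^ (j + 1)) ∧ (∀ k, (b.tgt k - ((((a.src k).val * F.L ^ (j + 1) : ℕ)) : ZMod ((F.P K).sitesPerDir 0)) + ((8 * F.L ^ (j + 1) : ℕ) : ZMod ((F.P K).sitesPerDir 0))).val < 17 * F.L ^ (j + 1)) then GaugeGroup.dist1 (U b * (U' b)⁻¹) ^ 2 else 0) ≤ 6 * dist1 g₀ ^ 2 := by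
    calc (∑ b : PBond (F.P K) 0, if (∀ k, (b.src k - ((((a.src k).val * F.L ^ (j + 1) : ℕ)) : ZMod ((F.P K).sitesPerDir 0)) + ((8 * F.L ^ (j + 1) : ℕ) : ZMod ((F.P K).sitesPerDir 0))).val < 17 * F.L ^ (j + 1)) ∧ (∀ k, (b.tgt k - ((((a.src k).val * F.L ^ (j + 1) : ℕ)) : ZMod ((F.P K).sitesPerDir 0)) + ((8 * F.L ^ (j + 1) : ℕ) : ZMod ((F.P K).sitesPerDir 0))).val < 17 * F.L ^ (j + 1)) then GaugeGroup.dist1 (U b * (U' b)⁻¹) ^ 2 else 0)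
        ≤ ∑ b : PBond (F.P K) 0, GaugeGroup.dist1 (U b * (U' b)⁻¹) ^ 2 :=
          Finset.sum_le_sum fun b _ => by
            split_ifs
            · exact le_rfl
            · exact sq_nonneg _
      _ ≤ ∑ b : PBond (F.P K) 0, dist1 g₀ ^ 2 * ((if b.src = x₀ then 1 else 0) + (if b.tgt = x₀ then 1 else 0)) :=
          Finset.sum_le_sum fun b _ => hterm b
      _ = 6 * dist1 g₀ ^ 2 := by
          rw [← Finset.mul_sum, Finset.sum_add_distrib, hcount_src, hcount_tgt]; ring
  -- contradiction: `D ≤ CS/√(3^{j+1}) · √(6 D²) < D`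
  have hD : 0 < dist1 g₀ := dist1_negOne_pos
  rw [hLHS] at key
  have hL3 : ((F.L : ℕ) : ℝ) = 3 := by show ((3 : ℕ) : ℝ) = 3; norm_num
  rw [hL3] at key
  have h3pos : (0 : ℝ) < (3 : ℝ) ^ (j + 1) := by positivity
  have hsq3 : 0 < Real.sqrt ((3 : ℝ) ^ (j + 1)) := Real.sqrt_pos.mpr h3pos
  have hle : dist1 g₀ ≤ CS / Real.sqrt ((3 : ℝ) ^ (j + 1)) * Real.sqrt (6 * dist1 g₀ ^ 2) :=
    key.trans (mul_le_mul_of_nonneg_left (Real.sqrt_le_sqrt hS) (div_nonneg hCS hsq3.le))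
  have hsq6 : Real.sqrt (6 * dist1 g₀ ^ 2) = Real.sqrt 6 * dist1 g₀ := by
    rw [Real.sqrt_mul (by norm_num), Real.sqrt_sq hD.le]
  rw [hsq6] at hle
  -- divide by `D > 0`: `√(3^{j+1}) ≤ CS·√6`
  have h1 : Real.sqrt ((3 : ℝ) ^ (j + 1)) ≤ CS * Real.sqrt 6 := by
    have e : CS / Real.sqrt ((3 : ℝ) ^ (j + 1)) * (Real.sqrt 6 * dist1 g₀) =
        (CS * Real.sqrt 6 / Real.sqrt ((3 : ℝ) ^ (j + 1))) * dist1 g₀ := by ring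
    rw [e] at hle
    have h2 : 1 ≤ CS * Real.sqrt 6 / Real.sqrt ((3 : ℝ) ^ (j + 1)) := by
      by_contra hlt
      have hlt' : CS * Real.sqrt 6 / Real.sqrt ((3 : ℝ) ^ (j + 1)) < 1 := lt_of_not_ge hlt
      have : CS * Real.sqrt 6 / Real.sqrt ((3 : ℝ) ^ (j + 1)) * dist1 g₀ < 1 * dist1 g₀ := mul_lt_mul_of_pos_right hlt' hD
      linarith
    rwa [le_div_iff₀ hsq3, one_mul] at h2
  have h2 : (3 : ℝ) ^ (j + 1) ≤ 6 * CS ^ 2 := by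
    have h6 : Real.sqrt 6 ^ 2 = 6 := Real.sq_sqrt (by norm_num)
    calc (3 : ℝ) ^ (j + 1) = Real.sqrt ((3 : ℝ) ^ (j + 1)) ^ 2 := (Real.sq_sqrt h3pos.le).symm
      _ ≤ (CS * Real.sqrt 6) ^ 2 := pow_le_pow_left₀ hsq3.le h1 2
      _ = 6 * CS ^ 2 := by rw [mul_pow, h6]; ring
  linarith

end Witness

end Summit.QuantumFields.YangMills.Theorems.PoincareLipschitzAvgStabilityGaugeWitness
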